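import Summits.Ventures.CertifiedManyBodySolver.Downfold.TperpSeamSharp
import Summits.Ventures.CertifiedManyBodySolver.Downfold.BoxesWordsAfChord
import HarnessLib

/-!
# LAYERED-CRYSTAL words on the two typed boxes with a `tperp/t` row through hubbard-box-p1's SHARP interlayer seam
# (floor inflation `(4/π)·max|tperp/t|` instead of `2·max|tperp/t|`): La-214 x = 1/8 v1.10 object M, Na-CCOC M36 object M

Venture CertifiedManyBodySolver, cell `pub/hubbard-downfold` (stage S1 ↔ S2 seam), seat hubbard-downfold-mod-1; namespace
`Summit.Ventures.CertifiedManyBodySolver.Downfold`. Sequel of `TperpSeamWords.lean` (p505967, constant `2`). hubbard-box-p1's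
`Downfold/TperpSeamSharp.lean` (p517341) re-proves the vertical seam with the kinematic constant `4/π` per vertical bond
(`Literature/…/SingleDirectionHoppingKinematicRow`: `|e_{Φ_v}(ω)| ≤ (4/π)|t|` for every translation-invariant state — the free Fermi-chain
bound): `holdsOn_verticalHubbardTTPrime_of_window_sharp`, same hypotheses as the constant-2 seam. This file re-keys the typed-box words on it:

* window-parametric `boxLa214M_M15v110_layeredEnergyWord_sharp` / `boxCCOCM_M36_layeredEnergyWord_sharp` (ANY S2 window `[L, R]` ⇒
  `[L − (4/π)·(17/200), R]` resp. `[L − (4/π)·(1/125), R]` for the simple-tetragonal t–t′–t_z crystal);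
* hypothesis-free instances on hubbard-box-p2's windows: sandwich (`sw_la214Mv110_M15_word`, `sw_naccocM_M36_word`) and AF-chord
  (`sw_afc_la214M_M15v110_word`, `sw_afc_ccocM_M36_word`): La-214 M15 `[−1.6068078874 − (4/π)(17/200), −0.3628345691]` / AF-chord cap
  `−0.4120625551`; CCOC M36 `[−1.6057583347 − (4/π)(1/125), −0.2996777356]` / AF-chord cap `−0.3867404523`;
* allowances `(4/π)(17/200) ≤ 0.1083`, `(4/π)(1/125) ≤ 0.0102` and decimal enclosures `[−1.7152, −0.412]` (La-214 M15, AF-chord) /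
  `[−1.616, −0.3867]` (CCOC M36, AF-chord) — vs `[−1.777, …]` / `[−1.622, …]` with the constant 2.

HONEST FRAMING: energy words only; simple-tetragonal (one vertical bond) stacking — the every-pattern / bilayer words keep the constant 2 per
bond class (box-p1: a periodic state can dimerise a bond class); the boxes are S1's screening-grade intervals typed verbatim; nothing about order,
pairing, `T_c` or a phase word. Everything is PROVED; no definition, no `sorry`.
-/

noncomputable section

namespace Summit.Ventures.CertifiedManyBodySolver.Downfold

open NonemptyInterval Literature.MathematicalPhysics.QuantumLattice
  Literature.MathematicalPhysics.QuantumLattice.ThermodynamicLimit Literature.Probability.LatticeModels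
  Summit.Ventures.CertifiedManyBodySolver.Certificates

/-! ### §1 La₂₋ₓSrₓCuO₄ x = 1/8, v1.10 object-M cell, `tperp/t ∈ [0.025, 0.085]` -/

/-- **Sharp layered-crystal word on `boxLa214M_M15v110` from ANY S2 window** (constant `4/π` per vertical bond): `L − (4/π)·(17/200) ≤ e ≤ R`
on the box. [folklore] -/
theorem boxLa214M_M15v110_layeredEnergyWord_sharp {L R : ℝ}
    (hE : ∀ θ ∈ Set.Icc (![51/10, -17/100, 171/200] : Fin 3 → ℝ) ![137/10, -3/100, 179/200],
      L ≤ energyDensityTT' 1 (θ 1) (θ 0) (θ 2) ∧ energyDensityTT' 1 (θ 1) (θ 0) (θ 2) ≤ R) :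
    HoldsOn (fun p : OneBandCoord → ℝ =>
      L - 4 / Real.pi * (17/200 : ℝ) ≤
          (layeredHubbardTTPrime 1 (p .tpOverT) (p .UOverT) (fun _ : Fin 1 => (unitVec (0 : Fin 3) : Site 3))
            fun _ => p .tperpOverT).tiGroundEnergyDensityAt 1 (p .filling) ∧
        (layeredHubbardTTPrime 1 (p .tpOverT) (p .UOverT) (fun _ : Fin 1 => (unitVec (0 : Fin 3) : Site 3))
            fun _ => p .tperpOverT).tiGroundEnergyDensityAt 1 (p .filling) ≤ R) boxLa214M_M15v110 := by
  have h := holdsOn_verticalHubbardTTPrime_of_window_sharp (B := boxLa214M_M15v110) (eU := la214M_v110_U)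
    (eS := la214M_M15v19_tp) (eN := la214M_M15v19_n) (eZ := la214M_M15v19_tperp) boxLa214M_M15v110_U
    boxLa214M_M15v110_tp boxLa214M_M15v110_n boxLa214M_M15v110_tperp
    (by rw [la214M_v110_U, Entry.encl_ofEnds_fst]; norm_num)
    (by rw [la214M_M15v19_n, Entry.encl_ofEnds_fst]; norm_num)
    (by rw [la214M_M15v19_n, Entry.encl_ofEnds_snd]; norm_num)
    (L := L) (R := R) (by rw [la214M_M15v110_s2Lo, la214M_M15v110_s2Hi]; exact hE)
  rw [la214M_M15v19_tperp_abs] at h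
  have hc : (((17/200 : ℚ)) : ℝ) = (17/200 : ℝ) := by norm_num
  rw [hc] at h
  exact h

/-- The sharp interlayer allowance on the La-214 M15 cell: `(4/π)·(17/200) ≤ 0.1083` (`Real.pi_gt_d6`). [folklore] -/
theorem la214M_M15_tperp_allowance_sharp_le : 4 / Real.pi * (17/200 : ℝ) ≤ 0.1083 := by
  have hπ := Real.pi_gt_d6
  rw [div_mul_eq_mul_div, div_le_iff₀ Real.pi_pos]
  nlinarith

/-- **Hypothesis-free SHARP layered word on `boxLa214M_M15v110`** (sandwich window `sw_la214Mv110_M15_word`):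
`[−1.6068078874 − (4/π)(17/200), −0.3628345691]`. [folklore] -/
theorem boxLa214M_M15v110_layered_word_sandwich_sharp :
    HoldsOn (fun p : OneBandCoord → ℝ =>
      (-1.6068078874 : ℝ) - 4 / Real.pi * (17/200 : ℝ) ≤
          (layeredHubbardTTPrime 1 (p .tpOverT) (p .UOverT) (fun _ : Fin 1 => (unitVec (0 : Fin 3) : Site 3))
            fun _ => p .tperpOverT).tiGroundEnergyDensityAt 1 (p .filling) ∧
        (layeredHubbardTTPrime 1 (p .tpOverT) (p .UOverT) (fun _ : Fin 1 => (unitVec (0 : Fin 3) : Site 3))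
            fun _ => p .tperpOverT).tiGroundEnergyDensityAt 1 (p .filling) ≤ (-0.3628345691 : ℝ)) boxLa214M_M15v110 :=
  boxLa214M_M15v110_layeredEnergyWord_sharp sw_la214Mv110_M15_word

/-- **Hypothesis-free SHARP layered AF-chord word on `boxLa214M_M15v110`** (`sw_afc_la214M_M15v110_word`):
`[−1.6068078874 − (4/π)(17/200), −0.4120625551]`. [folklore] -/
theorem boxLa214M_M15v110_layered_word_afChord_sharp :
    HoldsOn (fun p : OneBandCoord → ℝ =>
      (-1.6068078874 : ℝ) - 4 / Real.pi * (17/200 : ℝ) ≤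
          (layeredHubbardTTPrime 1 (p .tpOverT) (p .UOverT) (fun _ : Fin 1 => (unitVec (0 : Fin 3) : Site 3))
            fun _ => p .tperpOverT).tiGroundEnergyDensityAt 1 (p .filling) ∧
        (layeredHubbardTTPrime 1 (p .tpOverT) (p .UOverT) (fun _ : Fin 1 => (unitVec (0 : Fin 3) : Site 3))
            fun _ => p .tperpOverT).tiGroundEnergyDensityAt 1 (p .filling) ≤ (-0.4120625551 : ℝ)) boxLa214M_M15v110 :=
  boxLa214M_M15v110_layeredEnergyWord_sharp sw_afc_la214M_M15v110_word

/-- **Decimal enclosure** of the sharp layered AF-chord word on `boxLa214M_M15v110`: `−1.7152 ≤ e ≤ −0.412` (was `−1.777` with the constant 2). [folklore] -/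
theorem boxLa214M_M15v110_layered_word_afChord_sharp_decimal :
    HoldsOn (fun p : OneBandCoord → ℝ =>
      (-1.7152 : ℝ) ≤
          (layeredHubbardTTPrime 1 (p .tpOverT) (p .UOverT) (fun _ : Fin 1 => (unitVec (0 : Fin 3) : Site 3))
            fun _ => p .tperpOverT).tiGroundEnergyDensityAt 1 (p .filling) ∧
        (layeredHubbardTTPrime 1 (p .tpOverT) (p .UOverT) (fun _ : Fin 1 => (unitVec (0 : Fin 3) : Site 3))
            fun _ => p .tperpOverT).tiGroundEnergyDensityAt 1 (p .filling) ≤ (-0.412 : ℝ)) boxLa214M_M15v110 := by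
  refine boxLa214M_M15v110_layered_word_afChord_sharp.mono fun p hp => ?_
  have ha := la214M_M15_tperp_allowance_sharp_le
  constructor
  · linarith [hp.1]
  · linarith [hp.2]

/-! ### §2 Ca₂₋ₓNaₓCuO₂Cl₂ x = 0.10 object-M cell of box #36, `tperp/t ∈ [0.005, 0.008]` -/

/-- **Sharp layered-crystal word on `boxCCOCM_M36` from ANY S2 window**: `L − (4/π)·(1/125) ≤ e ≤ R` on the box. [folklore] -/
theorem boxCCOCM_M36_layeredEnergyWord_sharp {L R : ℝ}
    (hE : ∀ θ ∈ Set.Icc (![157/25, -237/1000, 22/25] : Fin 3 → ℝ) ![59/5, -19/250, 23/25],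
      L ≤ energyDensityTT' 1 (θ 1) (θ 0) (θ 2) ∧ energyDensityTT' 1 (θ 1) (θ 0) (θ 2) ≤ R) :
    HoldsOn (fun p : OneBandCoord → ℝ =>
      L - 4 / Real.pi * (1/125 : ℝ) ≤
          (layeredHubbardTTPrime 1 (p .tpOverT) (p .UOverT) (fun _ : Fin 1 => (unitVec (0 : Fin 3) : Site 3))
            fun _ => p .tperpOverT).tiGroundEnergyDensityAt 1 (p .filling) ∧
        (layeredHubbardTTPrime 1 (p .tpOverT) (p .UOverT) (fun _ : Fin 1 => (unitVec (0 : Fin 3) : Site 3))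
            fun _ => p .tperpOverT).tiGroundEnergyDensityAt 1 (p .filling) ≤ R) boxCCOCM_M36 := by
  have h := holdsOn_verticalHubbardTTPrime_of_window_sharp (B := boxCCOCM_M36) (eU := cCOCM_M36_U) (eS := cCOCM_M36_tp)
    (eN := cCOCM_M36_n) (eZ := cCOCM_M36_tperp) rfl rfl rfl rfl
    (by rw [cCOCM_M36_U, Entry.encl_ofEnds_fst]; norm_num)
    (by rw [cCOCM_M36_n, Entry.encl_ofEnds_fst]; norm_num)
    (by rw [cCOCM_M36_n, Entry.encl_ofEnds_snd]; norm_num)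
    (L := L) (R := R) (by rw [cCOCM_M36_s2Lo, cCOCM_M36_s2Hi]; exact hE)
  rw [cCOCM_M36_tperp_abs] at h
  have hc : (((1/125 : ℚ)) : ℝ) = (1/125 : ℝ) := by norm_num
  rw [hc] at h
  exact h

/-- The sharp interlayer allowance on the CCOC M36 cell: `(4/π)·(1/125) ≤ 0.0102`. [folklore] -/
theorem cCOCM_M36_tperp_allowance_sharp_le : 4 / Real.pi * (1/125 : ℝ) ≤ 0.0102 := by
  have hπ := Real.pi_gt_d6
  rw [div_mul_eq_mul_div, div_le_iff₀ Real.pi_pos]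
  nlinarith

/-- **Hypothesis-free SHARP layered word on `boxCCOCM_M36`** (sandwich window `sw_naccocM_M36_word`):
`[−1.6057583347 − (4/π)(1/125), −0.2996777356]`. [folklore] -/
theorem boxCCOCM_M36_layered_word_sandwich_sharp :
    HoldsOn (fun p : OneBandCoord → ℝ =>
      (-1.6057583347 : ℝ) - 4 / Real.pi * (1/125 : ℝ) ≤
          (layeredHubbardTTPrime 1 (p .tpOverT) (p .UOverT) (fun _ : Fin 1 => (unitVec (0 : Fin 3) : Site 3))
            fun _ => p .tperpOverT).tiGroundEnergyDensityAt 1 (p .filling) ∧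
        (layeredHubbardTTPrime 1 (p .tpOverT) (p .UOverT) (fun _ : Fin 1 => (unitVec (0 : Fin 3) : Site 3))
            fun _ => p .tperpOverT).tiGroundEnergyDensityAt 1 (p .filling) ≤ (-0.2996777356 : ℝ)) boxCCOCM_M36 :=
  boxCCOCM_M36_layeredEnergyWord_sharp sw_naccocM_M36_word

/-- **Hypothesis-free SHARP layered AF-chord word on `boxCCOCM_M36`** (`sw_afc_ccocM_M36_word`):
`[−1.6057583347 − (4/π)(1/125), −0.3867404523]`. [folklore] -/
theorem boxCCOCM_M36_layered_word_afChord_sharp :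
    HoldsOn (fun p : OneBandCoord → ℝ =>
      (-1.6057583347 : ℝ) - 4 / Real.pi * (1/125 : ℝ) ≤
          (layeredHubbardTTPrime 1 (p .tpOverT) (p .UOverT) (fun _ : Fin 1 => (unitVec (0 : Fin 3) : Site 3))
            fun _ => p .tperpOverT).tiGroundEnergyDensityAt 1 (p .filling) ∧
        (layeredHubbardTTPrime 1 (p .tpOverT) (p .UOverT) (fun _ : Fin 1 => (unitVec (0 : Fin 3) : Site 3))
            fun _ => p .tperpOverT).tiGroundEnergyDensityAt 1 (p .filling) ≤ (-0.3867404523 : ℝ)) boxCCOCM_M36 :=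
  boxCCOCM_M36_layeredEnergyWord_sharp sw_afc_ccocM_M36_word

/-- **Decimal enclosure** of the sharp layered AF-chord word on `boxCCOCM_M36`: `−1.616 ≤ e ≤ −0.3867` (was `−1.622`). [folklore] -/
theorem boxCCOCM_M36_layered_word_afChord_sharp_decimal :
    HoldsOn (fun p : OneBandCoord → ℝ =>
      (-1.616 : ℝ) ≤
          (layeredHubbardTTPrime 1 (p .tpOverT) (p .UOverT) (fun _ : Fin 1 => (unitVec (0 : Fin 3) : Site 3))
            fun _ => p .tperpOverT).tiGroundEnergyDensityAt 1 (p .filling) ∧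
        (layeredHubbardTTPrime 1 (p .tpOverT) (p .UOverT) (fun _ : Fin 1 => (unitVec (0 : Fin 3) : Site 3))
            fun _ => p .tperpOverT).tiGroundEnergyDensityAt 1 (p .filling) ≤ (-0.3867 : ℝ)) boxCCOCM_M36 := by
  refine boxCCOCM_M36_layered_word_afChord_sharp.mono fun p hp => ?_
  have ha := cCOCM_M36_tperp_allowance_sharp_le
  constructor
  · linarith [hp.1]
  · linarith [hp.2]

end Summit.Ventures.CertifiedManyBodySolver.Downfold

end
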